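import Summits.CriticalPhenomena.PercolationContinuityZ3.Theses.PercBoundarySqueeze
import Literature.Probability.Percolation.GMFiniteSize
import Literature.Probability.Percolation.ConnectivityProofs
import Literature.Probability.Percolation.PercolationProofs

/-!
# `FreeBoxSqueeze` (route PercBoundarySqueeze, item stmt-CriticalPhenomena-6984)

The unconditional squeeze of route `PercBoundarySqueeze` for bond percolation on `ℤ³` at
`p = p_c`: for all `R, n ≥ 1`, with `Λ = box 3 R`, core `K = box 3 (R/2)` and `∂Λ` the inner
vertex boundary of `Λ`,

  `θ(p_c) · |K| ≤ n · ∑_{v ∈ ∂Λ} P(∃ x ∈ K, v ↔ x in Λ) + ∑_{x ∈ K} P(∃ T, n ≤ |T|, ∀ y ∈ T, x ↔ y in Λ)`.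

## Proof

* Pointwise, for a lattice configuration `ω ⊆ E(ℤ³)` (almost sure): a percolating `x ∈ K` is joined
  inside `Λ` to `∂Λ` (an infinite open path leaves the finite box through its inner boundary,
  `toBdry_of_percolatesAt`). Call `x` *big* if some finset `T` with `n ≤ |T|` consists of vertices
  joined to `x` inside `Λ`. The percolating points of `K` that are not big are counted by double
  counting the relation `x ↔ v in Λ` between them and the boundary vertices `v ∈ ∂Λ` joined to `K`
  inside `Λ`: every such `x` has at least one partner `v`, and every `v` has at most `n` partners
  (all partners of `v` are joined inside `Λ` to any one of them, `x₀`, so `n` partners would make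
  `x₀` big). Hence `#{x ∈ K : x ↔ ∞} ≤ n · #{v ∈ ∂Λ : v ↔ K in Λ} + #{x ∈ K : x big}`
  (`card_filter_percolatesAt_le`).
* Integrate the three sums of indicators (`mul_card_le_of_ae`) and use translation invariance
  `θ_x = θ_0` (`theta_zdGraph_eq_theta_zero`).

Tree API: `toBdry_of_percolatesAt` (GMFiniteSize), `GM.openConnIn_comm`, `GM.openConnIn_trans`
(SeedLemma), `DCT16.measurableSet_openConnIn`, `measurableSet_percolatesAt_holds`,
`theta_zdGraph_eq_theta_zero`, `box_mono`. Mathlib: `Finset.card_mul_le_card_mul` (double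
counting), `integral_finsetSum`, `integral_indicator_one`, `ProbabilityTheory.setBernoulli_ae_subset`.
-/

noncomputable section

namespace Summit.CriticalPhenomena.PercolationContinuityZ3.Theorems

open MeasureTheory ProbabilityTheory
open Literature.Probability.Percolation Literature.Probability.LatticeModels
open Summit.CriticalPhenomena.PercolationContinuityZ3.Theses.PercBoundarySqueeze
open scoped Classical

namespace FreeBoxSqueeze

/-! ### The pointwise count -/

/-- **Pointwise count.** For a lattice configuration `ω ⊆ E(ℤ^d)`, `k ≤ m` and any `n`:
`#{x ∈ Λ_k : x ↔ ∞} ≤ n · #{v ∈ ∂Λ_m : v ↔ Λ_k in Λ_m} + #{x ∈ Λ_k : ∃ T, n ≤ |T|, ∀ y ∈ T, x ↔ y in Λ_m}`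
(every percolating point exits `Λ_m` through `∂Λ_m`; double counting of the relation `x ↔ v in Λ_m`
between the non-big percolating points and the boundary vertices joined to `Λ_k`). The three
filters carry the bare classical decidability instances, so that the statement matches the
instantiated hypothesis of `mul_card_le_of_ae` syntactically (no unfolding of finset data). -/
theorem card_filter_percolatesAt_le (d : ℕ) {k m : ℕ} (hkm : k ≤ m) (n : ℕ)
    {ω : BondConfig (Site d)} (hω : ω ⊆ (zdGraph d).edgeSet) :
    (@Finset.filter (Site d) (fun x => ω ∈ percolatesAt x)
        (fun _ => Classical.propDecidable _) (box d k)).card ≤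
      n * (@Finset.filter (Site d)
            (fun v => ∃ x ∈ box d k, ω ∈ openConnIn (↑(box d m) : Set (Site d)) v x)
            (fun _ => Classical.propDecidable _) (innerBoundary (zdGraph d) (box d m))).card +
        (@Finset.filter (Site d) (fun x => ∃ T : Finset (Site d), n ≤ T.card ∧
            ∀ y ∈ T, ω ∈ openConnIn (↑(box d m) : Set (Site d)) x y)
            (fun _ => Classical.propDecidable _) (box d k)).card := by
  set Λ : Set (Site d) := (↑(box d m) : Set (Site d))
  set big : Site d → Prop := fun x => ∃ T : Finset (Site d), n ≤ T.card ∧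
    ∀ y ∈ T, ω ∈ openConnIn Λ x y
  set P := (box d k).filter fun x => ω ∈ percolatesAt x
  set Bg := (box d k).filter fun x => big x
  set Vs := @Finset.filter (Site d) (fun v => ∃ x ∈ box d k, ω ∈ openConnIn Λ v x)
    (fun _ => Classical.propDecidable _) (innerBoundary (zdGraph d) (box d m))
  set Sm := P.filter fun x => ¬ big x
  set r : Site d → Site d → Prop := fun x v => ω ∈ openConnIn Λ x v
  -- split the percolating points into non-big and big ones
  have hsplit : P.card ≤ Sm.card + Bg.card := by
    calc P.card ≤ (Sm ∪ Bg).card := Finset.card_le_card ?_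
      _ ≤ Sm.card + Bg.card := Finset.card_union_le _ _
    intro x hx
    by_cases hb : big x
    · exact Finset.mem_union_right _ (Finset.mem_filter.2 ⟨(Finset.mem_filter.1 hx).1, hb⟩)
    · exact Finset.mem_union_left _ (Finset.mem_filter.2 ⟨hx, hb⟩)
  -- double counting of `r` between `Sm` and `Vs`
  have hdc : Sm.card * 1 ≤ Vs.card * n := by
    refine Finset.card_mul_le_card_mul r ?_ ?_
    · -- every non-big percolating `x` is joined inside `Λ_m` to some `v ∈ Vs`
      intro x hx
      obtain ⟨hxP, -⟩ := Finset.mem_filter.1 hx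
      obtain ⟨hxk, hperc⟩ := Finset.mem_filter.1 hxP
      obtain ⟨v, hv, hxv⟩ := toBdry_of_percolatesAt (box_mono d hkm hxk) hω hperc
      refine Finset.card_pos.2 ⟨v, ?_⟩
      rw [Finset.mem_bipartiteAbove]
      -- `(_)`: the decidability instance of `Vs` is taken by unification, not synthesis
      exact ⟨(@Finset.mem_filter _ _ (_) _ _).2 ⟨hv, x, hxk, GM.openConnIn_comm.1 hxv⟩, hxv⟩
    · -- every `v` has at most `n` non-big partners
      intro v _
      by_contra hcon
      push Not at hcon
      obtain ⟨x₀, hx₀⟩ : (Sm.bipartiteBelow r v).Nonempty := Finset.card_pos.1 (by omega)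
      rw [Finset.mem_bipartiteBelow] at hx₀
      obtain ⟨hx₀S, hx₀v⟩ := hx₀
      obtain ⟨-, hx₀s⟩ := Finset.mem_filter.1 hx₀S
      refine hx₀s ⟨Sm.bipartiteBelow r v, hcon.le, fun y hy => ?_⟩
      rw [Finset.mem_bipartiteBelow] at hy
      exact GM.openConnIn_trans hx₀v (GM.openConnIn_comm.1 hy.2)
  have hSm : Sm.card ≤ n * Vs.card := by
    rw [mul_one, mul_comm] at hdc
    exact hdc
  calc P.card ≤ Sm.card + Bg.card := hsplit
    _ ≤ n * Vs.card + Bg.card := Nat.add_le_add_right hSm _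

/-! ### Measurability of the two events -/

/-- `{v ↔ Λ_k in Λ_m}` is measurable (finite union of `openConnIn` cylinder events). -/
theorem measurableSet_connCore (d k m : ℕ) (v : Site d) :
    MeasurableSet {ω : BondConfig (Site d) |
      ∃ x ∈ box d k, ω ∈ openConnIn (↑(box d m) : Set (Site d)) v x} := by
  have : {ω : BondConfig (Site d) | ∃ x ∈ box d k, ω ∈ openConnIn (↑(box d m) : Set (Site d)) v x} =
      ⋃ x ∈ box d k, openConnIn (↑(box d m) : Set (Site d)) v x := by
    ext ω; simp
  rw [this]
  exact MeasurableSet.biUnion (Finset.countable_toSet _) fun x _ =>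
    DCT16.measurableSet_openConnIn _ v x

/-- `{∃ T, n ≤ |T|, ∀ y ∈ T, x ↔ y in Λ_m}` is measurable (countably many finsets `T`). -/
theorem measurableSet_big (d m n : ℕ) (x : Site d) :
    MeasurableSet {ω : BondConfig (Site d) | ∃ T : Finset (Site d), n ≤ T.card ∧
      ∀ y ∈ T, ω ∈ openConnIn (↑(box d m) : Set (Site d)) x y} := by
  refine measurableSet_setOf.2 (Measurable.exists fun T => ?_)
  refine Measurable.and measurable_const (Measurable.forall fun y => ?_)
  exact Measurable.imp measurable_const (DCT16.measurableSet_openConnIn _ x y).mem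

/-! ### Integration of the pointwise count -/

/-- **The abstract mean inequality.** For a probability measure `μ`, finite index sets `B`, `Ks`,
measurable events `Pev x` of common probability `θ` on `B`, `R k` and `Q x`: if almost surely
`#{x ∈ B : Pev x} ≤ n · #{k ∈ Ks : R k} + #{x ∈ B : Q x}`, then
`θ · |B| ≤ n · ∑_k μ(R k) + ∑_x μ(Q x)` (integrate the three sums of indicators). -/
theorem mul_card_le_of_ae {α ι κ : Type*} [MeasurableSpace α] (μ : Measure α)
    [IsProbabilityMeasure μ] (B : Finset ι) (Ks : Finset κ) (n : ℕ)
    {Pev : ι → Set α} {R : κ → Set α} {Q : ι → Set α}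
    (hP : ∀ x, MeasurableSet (Pev x)) (hR : ∀ k, MeasurableSet (R k))
    (hQ : ∀ x, MeasurableSet (Q x)) {θ : ℝ} (hθ : ∀ x ∈ B, μ.real (Pev x) = θ)
    (hpt : ∀ᵐ a ∂μ, (B.filter fun x => a ∈ Pev x).card ≤
        n * (Ks.filter fun k => a ∈ R k).card + (B.filter fun x => a ∈ Q x).card) :
    θ * (B.card : ℝ) ≤ (n : ℝ) * ∑ k ∈ Ks, μ.real (R k) + ∑ x ∈ B, μ.real (Q x) := by
  -- the three random variables as sums of indicators
  have hVint1 : ∀ x, Integrable (fun a => (Pev x).indicator (1 : α → ℝ) a) μ := fun x =>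
    (integrable_const (1 : ℝ)).indicator (hP x)
  have hNint1 : ∀ k, Integrable (fun a => (R k).indicator (1 : α → ℝ) a) μ := fun k =>
    (integrable_const (1 : ℝ)).indicator (hR k)
  have hQint1 : ∀ x, Integrable (fun a => (Q x).indicator (1 : α → ℝ) a) μ := fun x =>
    (integrable_const (1 : ℝ)).indicator (hQ x)
  have hVi : Integrable (fun a => ∑ x ∈ B, (Pev x).indicator (1 : α → ℝ) a) μ :=
    integrable_finsetSum B fun x _ => hVint1 x
  have hNi : Integrable (fun a => ∑ k ∈ Ks, (R k).indicator (1 : α → ℝ) a) μ :=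
    integrable_finsetSum Ks fun k _ => hNint1 k
  have hQi : Integrable (fun a => ∑ x ∈ B, (Q x).indicator (1 : α → ℝ) a) μ :=
    integrable_finsetSum B fun x _ => hQint1 x
  -- their means
  have hVint : ∫ a, (∑ x ∈ B, (Pev x).indicator (1 : α → ℝ) a) ∂μ = θ * B.card := by
    rw [integral_finsetSum B fun x _ => hVint1 x,
      Finset.sum_congr rfl fun x hx => (integral_indicator_one (hP x)).trans (hθ x hx),
      Finset.sum_const, nsmul_eq_mul, mul_comm]
  have hNint : ∫ a, (∑ k ∈ Ks, (R k).indicator (1 : α → ℝ) a) ∂μ = ∑ k ∈ Ks, μ.real (R k) := by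
    rw [integral_finsetSum Ks fun k _ => hNint1 k]
    exact Finset.sum_congr rfl fun k _ => integral_indicator_one (hR k)
  have hQint : ∫ a, (∑ x ∈ B, (Q x).indicator (1 : α → ℝ) a) ∂μ = ∑ x ∈ B, μ.real (Q x) := by
    rw [integral_finsetSum B fun x _ => hQint1 x]
    exact Finset.sum_congr rfl fun x _ => integral_indicator_one (hQ x)
  have hmono : ∫ a, (∑ x ∈ B, (Pev x).indicator (1 : α → ℝ) a) ∂μ ≤
      ∫ a, ((n : ℝ) * (∑ k ∈ Ks, (R k).indicator (1 : α → ℝ) a) +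
        ∑ x ∈ B, (Q x).indicator (1 : α → ℝ) a) ∂μ := by
    refine integral_mono_ae hVi ((hNi.const_mul (n : ℝ)).add hQi) ?_
    filter_upwards [hpt] with a ha
    simp only [Set.indicator_apply, Pi.one_apply, Finset.sum_boole]
    exact_mod_cast ha
  rw [integral_add (hNi.const_mul (n : ℝ)) hQi, integral_const_mul, hVint, hNint, hQint] at hmono
  exact hmono

end FreeBoxSqueeze

/-- **`FreeBoxSqueeze`** (item stmt-CriticalPhenomena-6984): for bond percolation on `ℤ³` at `p_c`
and all `R, n ≥ 1`,
`θ(p_c)·|Λ_{⌊R/2⌋}| ≤ n · ∑_{v ∈ ∂^{in}Λ_R} P(v ↔ Λ_{⌊R/2⌋} in Λ_R) + ∑_{x ∈ Λ_{⌊R/2⌋}} P(|C_{Λ_R}(x)| ≥ n)`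
(pointwise exit count a.s., double counting, expectation, translation invariance `θ_x = θ_0`). -/
theorem freeBoxSqueeze_proof : FreeBoxSqueeze := by
  unfold FreeBoxSqueeze
  intro R n _hR _hn
  refine FreeBoxSqueeze.mul_card_le_of_ae
    (bondPercolation (zdGraph 3) (criticalProbI 3)) (box 3 (R / 2))
    (innerBoundary (zdGraph 3) (box 3 R)) n
    (Pev := fun x => percolatesAt x)
    (R := fun v => {ω | ∃ x ∈ box 3 (R / 2), ω ∈ openConnIn (↑(box 3 R) : Set (Site 3)) v x})
    (Q := fun x => {ω | ∃ T : Finset (Site 3), n ≤ T.card ∧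
      ∀ y ∈ T, ω ∈ openConnIn (↑(box 3 R) : Set (Site 3)) x y})
    (fun x => measurableSet_percolatesAt_holds x)
    (fun v => FreeBoxSqueeze.measurableSet_connCore 3 (R / 2) R v)
    (fun x => FreeBoxSqueeze.measurableSet_big 3 R n x)
    (θ := theta (zdGraph 3) 0 (criticalProbI 3))
    (fun x _ => theta_zdGraph_eq_theta_zero (criticalProbI 3) x) ?_
  filter_upwards [(setBernoulli_ae_subset :
    ∀ᵐ ω ∂(bondPercolation (zdGraph 3) (criticalProbI 3)), ω ⊆ (zdGraph 3).edgeSet)] with ω hω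
  exact FreeBoxSqueeze.card_filter_percolatesAt_le 3 (Nat.div_le_self R 2) n hω

end Summit.CriticalPhenomena.PercolationContinuityZ3.Theorems
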